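import Summits.KontsevichZagierPeriods.KontsevichZagierPeriods.Theses.FurushoPentagon
import Summits.KontsevichZagierPeriods.KontsevichZagierPeriods.Theorems.FurushoPentagonReducedPeriodRingDefs
import Literature.NumberTheory.Transcendental.KZLogCalculusProofs
import Literature.NumberTheory.Transcendental.KZRulesAssociator
import Literature.NumberTheory.Transcendental.KZCubicalCalculus

/-!
# `ReducedPeriodRing`, line `effective-end-monoid`: merging a `ℤ`-combination of tame cube classes

Stub `stub_cubeMerge` (S1a) of the crux `FurushoPentagon.ReducedPeriodRing`
(stmt-KontsevichZagierPeriods-3929), line `effective-end-monoid`.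

A `ℤ`-linear combination of tame cube classes (an element of `cubicalSpan`, the subgroup of
`KZ.FormalRep` generated by the classes `[r]` with `r.domain = unitCube n` and `r.integrand` analytic
on a neighbourhood of the cube) is, modulo the Kontsevich–Zagier relations, ONE tame cube class.
Induction on the subgroup closure:

* generators are tame cube classes; `0 ∼ [[0,1]⁰, 0]` (a representation with vanishing integrand is a
  relation);
* `−[σ, f] ∼ [σ, −f]` (`KZ.of_add_of_mem_relations_of_eqOn_neg`);
* sums: both summands are first PADDED to a common dimension `n + m` by the Fubini products
  `[r] · [[0,1]ᵐ, 1]` and `[[0,1]ⁿ, 1] · [s]` — these are equivalent to `[r]`, `[s]` because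
  `[[0,1]ᵏ, 1] ∼ [pt, 1]` by `k` Newton–Leibniz moves along the last coordinate with primitive
  `F (x, t) = t` (`KZ.cubicalStokesGens ⊆ KZ.newtonLeibnizRel`, `KZCubicalCalculus.lean`) and
  `[pt, 1]` is a two-sided unit modulo relations (`KZRulesAssociator.lean`), `KZ.relations` being a
  two-sided ideal (`KZ.mul_sub_mul_mem_relations`) — and then merged by integrand additivity on the
  cube `[[0,1]ᴺ, f] + [[0,1]ᴺ, g] ∼ [[0,1]ᴺ, f + g]`.

The closed unit cube `unitCube n` of the line's vocabulary is definitionally the cube `KZ.cube n` of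
`Literature/NumberTheory/Transcendental/KZCubicalCalculus.lean`, whose tame-cube API
(`KZ.IntegralRep.tameCube`, `KZ.mem_cubicalStokesGens`, `KZ.mem_cubicalLinGens`) is reused.

References: M. Kontsevich, D. Zagier, *Periods* (2001), §1.2 rules (1), (3), §4.1;
J. Ayoub, *Periods and the conjectures of Grothendieck and Kontsevich–Zagier* (2014), Def. 10.
-/

noncomputable section

namespace Summit.KontsevichZagierPeriods.FurushoPentagon.ReducedPeriodRing

open Set
open Literature.NumberTheory.Transcendental Literature.NumberTheory.Transcendental.KZ

/-! ## Auxiliary lemmas -/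

/-- `unitCube n` is, by definition, the cube `KZ.cube n` of `KZCubicalCalculus.lean`. [folklore] -/
private theorem cubeMerge_unitCube_eq_cube (n : ℕ) : unitCube n = KZ.cube n := rfl

/-- The product domain of two cubes is the cube. [folklore] -/
private theorem cubeMerge_prodDomain_eq_unitCube {n m : ℕ} (r : IntegralRep n) (s : IntegralRep m)
    (hr : r.domain = unitCube n) (hs : s.domain = unitCube m) :
    IntegralRep.prodDomain r s = unitCube (n + m) := by
  ext z
  simp only [IntegralRep.mem_prodDomain, hr, hs, mem_unitCube]
  constructor
  · rintro ⟨h1, h2⟩ i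
    induction i using Fin.addCases with
    | left i => simpa using h1 i
    | right j => simpa using h2 j
  · intro h
    exact ⟨fun i => h _, fun j => h _⟩

/-- Restriction to the first `n` coordinates maps the cube to the cube. [folklore] -/
private theorem cubeMerge_castAdd_mem_unitCube {n m : ℕ} {z : Fin (n + m) → ℝ}
    (hz : z ∈ unitCube (n + m)) : (fun i => z (Fin.castAdd m i)) ∈ unitCube n := fun _ => hz _

/-- Restriction to the last `m` coordinates maps the cube to the cube. [folklore] -/
private theorem cubeMerge_natAdd_mem_unitCube {n m : ℕ} {z : Fin (n + m) → ℝ}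
    (hz : z ∈ unitCube (n + m)) : (fun j => z (Fin.natAdd n j)) ∈ unitCube m := fun _ => hz _

/-- `f ⊗ g` is analytic on a neighbourhood of the cube when `f`, `g` are (the two coordinate
restrictions are continuous linear, hence analytic). [folklore] -/
private theorem cubeMerge_analyticOnNhd_prodFun {n m : ℕ} (r : IntegralRep n) (s : IntegralRep m)
    (hr : AnalyticOnNhd ℝ r.integrand (unitCube n))
    (hs : AnalyticOnNhd ℝ s.integrand (unitCube m)) :
    AnalyticOnNhd ℝ (IntegralRep.prodFun r s) (unitCube (n + m)) := by
  let p₁ : (Fin (n + m) → ℝ) →L[ℝ] (Fin n → ℝ) :=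
    ContinuousLinearMap.pi fun i => ContinuousLinearMap.proj (Fin.castAdd m i)
  let p₂ : (Fin (n + m) → ℝ) →L[ℝ] (Fin m → ℝ) :=
    ContinuousLinearMap.pi fun j => ContinuousLinearMap.proj (Fin.natAdd n j)
  have h₁ : AnalyticOnNhd ℝ (fun z => r.integrand (p₁ z)) (unitCube (n + m)) :=
    hr.comp (p₁.analyticOnNhd _) fun z hz => cubeMerge_castAdd_mem_unitCube hz
  have h₂ : AnalyticOnNhd ℝ (fun z => s.integrand (p₂ z)) (unitCube (n + m)) :=
    hs.comp (p₂.analyticOnNhd _) fun z hz => cubeMerge_natAdd_mem_unitCube hz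
  have hfun : IntegralRep.prodFun r s = fun z => r.integrand (p₁ z) * s.integrand (p₂ z) := by
    funext z
    simp [IntegralRep.prodFun, p₁, p₂]
  rw [hfun]
  exact h₁.mul h₂

/-- The constant tame cube class `[[0,1]ᵏ, 1]` exists (`KZ.IntegralRep.tameCube`: the constant `1`
is analytic and, as a polynomial, `ℚ`-semialgebraic). [Ayoub 2014, Def. 10] -/
private theorem cubeMerge_exists_one (k : ℕ) :
    ∃ u : IntegralRep k, u.domain = unitCube k ∧ u.integrand = fun _ => 1 := by
  have h1 : IsSemialgebraicFunOn ℚ (KZ.cube k) (fun _ : Fin k → ℝ => (1 : ℝ)) := by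
    simpa using isSemialgebraicFunOn_aeval (R := ℝ) KZ.isSemialgebraic_cube
      (1 : MvPolynomial (Fin k) ℚ)
  exact ⟨IntegralRep.tameCube (fun _ => (1 : ℝ)) analyticOnNhd_const h1, rfl, rfl⟩

/-- **`[[0,1]ᵏ, 1] ∼ [pt, 1]`.** By induction on `k`: `[[0,1]ᵏ⁺¹, 1] − [[0,1]ᵏ, 1]` is a
Newton–Leibniz move along the last coordinate of the cube with the (linear, hence analytic and
`ℚ`-semialgebraic) primitive `F (x, t) = t`, `∂ₜ F = 1`, `F (x, 1) − F (x, 0) = 1`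
(`KZ.mem_cubicalStokesGens`, `KZ.cubicalStokesGens_subset_relations`); and `[[0,1]⁰, 1] = [pt, 1]`
(`KZ.IntegralRep.unit`) on the nose. [Kontsevich–Zagier 2001, §1.2 rule (3)] -/
private theorem cubeMerge_one_sub_unit : ∀ (k : ℕ) (u : IntegralRep k), u.domain = unitCube k →
    u.integrand = (fun _ => 1) → of u - of IntegralRep.unit ∈ relations := by
  intro k
  induction k with
  | zero =>
    intro u hd hi
    have hu : u = IntegralRep.unit :=
      IntegralRep.ext'
        (by rw [hd, IntegralRep.unit_domain, cubeMerge_unitCube_eq_cube, KZ.cube_zero])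
        (by rw [hi, IntegralRep.unit_integrand])
    rw [hu, sub_self]
    exact relations.zero_mem
  | succ k ih =>
    intro u hd hi
    obtain ⟨u', hd', hi'⟩ := cubeMerge_exists_one k
    have hua : AnalyticOnNhd ℝ u.integrand (KZ.cube (k + 1)) := by
      rw [hi]; exact analyticOnNhd_const
    have hua' : AnalyticOnNhd ℝ u'.integrand (KZ.cube k) := by
      rw [hi']; exact analyticOnNhd_const
    -- the primitive `F (z) = z (last k)`, a coordinate function
    have hFa : AnalyticOnNhd ℝ (fun z : Fin (k + 1) → ℝ => z (Fin.last k)) (KZ.cube (k + 1)) :=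
      (ContinuousLinearMap.proj (R := ℝ) (φ := fun _ : Fin (k + 1) => ℝ)
        (Fin.last k)).analyticOnNhd _
    have hmove : of u - of u' ∈ KZ.cubicalStokesGens := by
      refine KZ.mem_cubicalStokesGens (F := fun z => z (Fin.last k)) ⟨hd, hua⟩ ⟨hd', hua'⟩ hFa
        (isSemialgebraicFunOn_apply KZ.isSemialgebraic_cube (Fin.last k)) ?_ ?_
      · intro x _ t _
        rw [hi]
        simp only [Fin.snoc_last]
        exact hasDerivAt_id' t
      · intro x _
        simp [hi']
    have h1 : of u - of u' ∈ relations := KZ.cubicalStokesGens_subset_relations hmove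
    have h2 : of u' - of IntegralRep.unit ∈ relations := ih u' hd' hi'
    have : of u - of IntegralRep.unit = (of u - of u') + (of u' - of IntegralRep.unit) := by abel
    rw [this]
    exact relations.add_mem h1 h2

/-- **Right padding** `[σ, f] ∼ [σ × [0,1]ᵐ, f ⊗ 1]`: `[r] − [r] · [[0,1]ᵐ, 1] =
([r] · [pt, 1] − [r] · [[0,1]ᵐ, 1]) − ([r] · [pt, 1] − [r])`, two relations by the two-sided ideal
property (`KZ.mul_sub_mul_mem_relations`) and the right unit (`KZ.mul_of_unit_sub_mem_relations`); the
Fubini product of tame cube classes is a tame cube class. [Kontsevich–Zagier 2001, §4.1] -/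
private theorem cubeMerge_padRight {n : ℕ} (r : IntegralRep n) (hrd : r.domain = unitCube n)
    (hra : AnalyticOnNhd ℝ r.integrand (unitCube n)) (m : ℕ) :
    ∃ r' : IntegralRep (n + m), r'.domain = unitCube (n + m) ∧
      AnalyticOnNhd ℝ r'.integrand (unitCube (n + m)) ∧ of r - of r' ∈ relations := by
  obtain ⟨u, hud, hui⟩ := cubeMerge_exists_one m
  have hua : AnalyticOnNhd ℝ u.integrand (unitCube m) := by
    rw [hui]; exact analyticOnNhd_const
  refine ⟨r.prod u, ?_, ?_, ?_⟩
  · rw [IntegralRep.prod_domain, cubeMerge_prodDomain_eq_unitCube r u hrd hud]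
  · rw [IntegralRep.prod_integrand_eq]
    exact cubeMerge_analyticOnNhd_prodFun r u hra hua
  · have h0 : of IntegralRep.unit - of u ∈ relations := by
      rw [← neg_sub]; exact relations.neg_mem (cubeMerge_one_sub_unit m u hud hui)
    have h1 : of r * of IntegralRep.unit - of r * of u ∈ relations :=
      mul_sub_mul_mem_relations (by rw [sub_self]; exact relations.zero_mem) h0
    have h2 : of r * of IntegralRep.unit - of r ∈ relations := mul_of_unit_sub_mem_relations (of r)
    have : of r - of (r.prod u) =
        (of r * of IntegralRep.unit - of r * of u) - (of r * of IntegralRep.unit - of r) := by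
      rw [← of_mul_of]; abel
    rw [this]
    exact relations.sub_mem h1 h2

/-- **Left padding** `[τ, g] ∼ [[0,1]ⁿ × τ, 1 ⊗ g]`, symmetrically, with the left unit
(`KZ.of_unit_mul_sub_mem_relations`). [Kontsevich–Zagier 2001, §4.1] -/
private theorem cubeMerge_padLeft {m : ℕ} (s : IntegralRep m) (hsd : s.domain = unitCube m)
    (hsa : AnalyticOnNhd ℝ s.integrand (unitCube m)) (n : ℕ) :
    ∃ s' : IntegralRep (n + m), s'.domain = unitCube (n + m) ∧
      AnalyticOnNhd ℝ s'.integrand (unitCube (n + m)) ∧ of s - of s' ∈ relations := by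
  obtain ⟨u, hud, hui⟩ := cubeMerge_exists_one n
  have hua : AnalyticOnNhd ℝ u.integrand (unitCube n) := by
    rw [hui]; exact analyticOnNhd_const
  refine ⟨u.prod s, ?_, ?_, ?_⟩
  · rw [IntegralRep.prod_domain, cubeMerge_prodDomain_eq_unitCube u s hud hsd]
  · rw [IntegralRep.prod_integrand_eq]
    exact cubeMerge_analyticOnNhd_prodFun u s hua hsa
  · have h0 : of IntegralRep.unit - of u ∈ relations := by
      rw [← neg_sub]; exact relations.neg_mem (cubeMerge_one_sub_unit n u hud hui)
    have h1 : of IntegralRep.unit * of s - of u * of s ∈ relations :=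
      mul_sub_mul_mem_relations h0 (by rw [sub_self]; exact relations.zero_mem)
    have h2 : of IntegralRep.unit * of s - of s ∈ relations := of_unit_mul_sub_mem_relations (of s)
    have : of s - of (u.prod s) =
        (of IntegralRep.unit * of s - of u * of s) - (of IntegralRep.unit * of s - of s) := by
      rw [← of_mul_of]; abel
    rw [this]
    exact relations.sub_mem h1 h2

/-- **Sums in a common dimension**: `[[0,1]ᴺ, f] + [[0,1]ᴺ, g] ∼ [[0,1]ᴺ, f + g]`, an integrand
additivity move between tame cube classes (`KZ.mem_cubicalLinGens`,
`KZ.cubicalLinGens_subset_relations`; `f + g` is `ℚ`-semialgebraic by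
`IsSemialgebraicFunOn.add_holds`). [Kontsevich–Zagier 2001, §1.2 rule (1)] -/
private theorem cubeMerge_add {N : ℕ} (r s : IntegralRep N) (hrd : r.domain = unitCube N)
    (hra : AnalyticOnNhd ℝ r.integrand (unitCube N)) (hsd : s.domain = unitCube N)
    (hsa : AnalyticOnNhd ℝ s.integrand (unitCube N)) :
    ∃ t : IntegralRep N, t.domain = unitCube N ∧ AnalyticOnNhd ℝ t.integrand (unitCube N) ∧
      of r + of s - of t ∈ relations := by
  have hrs : IsSemialgebraicFunOn ℚ (unitCube N) r.integrand :=
    hrd ▸ r.isSemialgebraicFunOn_integrand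
  have hss : IsSemialgebraicFunOn ℚ (unitCube N) s.integrand :=
    hsd ▸ s.isSemialgebraicFunOn_integrand
  obtain ⟨t, htd, hti⟩ : ∃ t : IntegralRep N, t.domain = unitCube N ∧
      t.integrand = r.integrand + s.integrand :=
    ⟨IntegralRep.tameCube (r.integrand + s.integrand) (hra.add hsa)
      (IsSemialgebraicFunOn.add_holds hrs hss), rfl, rfl⟩
  have hta : AnalyticOnNhd ℝ t.integrand (unitCube N) := by
    rw [hti]; exact hra.add hsa
  refine ⟨t, htd, hta, ?_⟩
  have h : of t - of r - of s ∈ relations :=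
    KZ.cubicalLinGens_subset_relations
      (KZ.mem_cubicalLinGens ⟨htd, hta⟩ ⟨hrd, hra⟩ ⟨hsd, hsa⟩ fun x _ => by rw [hti])
  have : of r + of s - of t = -(of t - of r - of s) := by abel
  rw [this]
  exact relations.neg_mem h

/-! ## The stub -/

/-- **S1a (merging).** A `ℤ`-combination of tame cube classes is a single tame cube class modulo
the KZ relations: generators are tame cube classes, `0 ∼ [[0,1]⁰, 0]`, `−[σ, f] ∼ [σ, −f]`, and a
sum of two tame cube classes is padded to a common dimension (`[[0,1]ᵏ, 1] ∼ [pt, 1]` by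
Newton–Leibniz, two-sided ideal) and merged by integrand additivity.
[Kontsevich–Zagier 2001, §1.2] -/
theorem stub_cubeMerge : ∀ c : FormalRep, c ∈ cubicalSpan →
    ∃ (n : ℕ) (r : IntegralRep n), r.domain = unitCube n ∧
      AnalyticOnNhd ℝ r.integrand (unitCube n) ∧ c - of r ∈ relations := by
  intro c hc
  change c ∈ AddSubgroup.closure cubicalGens at hc
  induction hc using AddSubgroup.closure_induction with
  | mem x hx =>
    obtain ⟨n, r, hd, ha, rfl⟩ := hx
    exact ⟨n, r, hd, ha, by rw [sub_self]; exact relations.zero_mem⟩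
  | zero =>
    -- the zero representation on the point `[0,1]⁰`
    obtain ⟨z, hzd, hzi⟩ := exists_zeroRep (σ := unitCube 0) KZ.isSemialgebraic_cube
    refine ⟨0, z, hzd, ?_, ?_⟩
    · rw [hzi]; exact analyticOnNhd_const
    · rw [zero_sub]
      exact relations.neg_mem (of_mem_relations_of_eqOn_zero z fun x _ => by rw [hzi])
  | add x y _ _ hx hy =>
    obtain ⟨n, r, hrd, hra, hxr⟩ := hx
    obtain ⟨m, s, hsd, hsa, hys⟩ := hy
    obtain ⟨r', hr'd, hr'a, hrr'⟩ := cubeMerge_padRight r hrd hra m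
    obtain ⟨s', hs'd, hs'a, hss'⟩ := cubeMerge_padLeft s hsd hsa n
    obtain ⟨t, htd, hta, ht⟩ := cubeMerge_add r' s' hr'd hr'a hs'd hs'a
    refine ⟨n + m, t, htd, hta, ?_⟩
    have : x + y - of t =
        (x - of r) + (y - of s) + ((of r - of r') + (of s - of s') + (of r' + of s' - of t)) := by
      abel
    rw [this]
    exact relations.add_mem (relations.add_mem hxr hys)
      (relations.add_mem (relations.add_mem hrr' hss') ht)
  | neg x _ hx =>
    obtain ⟨n, r, hrd, hra, hxr⟩ := hx
    refine ⟨n, r.neg, hrd, hra.neg, ?_⟩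
    have h : of r + of r.neg ∈ relations :=
      of_add_of_mem_relations_of_eqOn_neg (r := r) (r' := r.neg) rfl fun _ _ => rfl
    have : -x - of r.neg = -(x - of r) - (of r + of r.neg) := by abel
    rw [this]
    exact relations.sub_mem (relations.neg_mem hxr) h

end Summit.KontsevichZagierPeriods.FurushoPentagon.ReducedPeriodRing
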